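import Mathlib
import Summits.Ventures.PercRepro2.Defs
import Summits.Ventures.PercRepro2.Independence
import Summits.Ventures.PercRepro2.Exploration
import Summits.Ventures.PercRepro2.CoinDefs

/-!
# Induced coin systems, the events `Q^U_A`, `R^U_X` and the in-frontier (blind cell PercRepro2,
night-2)

The directed counterpart of `Induced.lean` (p1's toolkit for undirected graphs) on COIN SYSTEMS
`arcs : E → Finset (V × V)` (`CoinDefs.lean`):

* `withinC arcs U` — the coins all of whose arcs have both endpoints in `U`; `inducedC arcs U ω`
  — the configuration with every coin not inside `U` closed: percolation on the induced coin
  system `D[U]`, on the *same* probability space; monotone in `ω` and in `U`, determined by the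
  coins inside `U`; `inducedC arcs Set.univ ω = ω`;
* `QEventC arcs U s A = {s ⇝ a in D[U] ∀ a ∈ A}` (increasing) and
  `REventC arcs U s X = {s ↛ x in D[U] ∀ x ∈ X}` (decreasing), with union / antitonicity /
  vanishing / `DependsOn` lemmas;
* `frontierC arcs U Z ω` — the IN-frontier of `Z`: the vertices of `U ∖ Z` carrying an open arc INTO
  `Z` (what the backward exploration of the arcs around `Z` reveals; `intoC arcs Z` = the coins
  with an arc into `Z`);
* `SameEnds arcs` — every two arcs of a coin have the same endpoint set (single arcs, antiparallel
  pairs, loops: the MIXED systems of row 2′DARC, NEG-80); it is the exact hypothesis under which a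
  coin carrying an arc inside `U'` lies inside `U'` (`mem_withinC_of_arc`), which is what the
  pointwise domain Markov identity of `CoinFrontier.lean` needs.
-/

namespace Summit.Ventures.PercRepro2.Coin

/-! ## The induced coin configuration -/

section Induced

open Classical

variable {V : Type*} {E : Type*}

/-- The coins lying inside `U`: every arc has both endpoints in `U`. -/
def withinC (arcs : E → Finset (V × V)) (U : Set V) : Set E :=
  {e | ∀ xy ∈ arcs e, xy.1 ∈ U ∧ xy.2 ∈ U}

/-- The coins with an arc INTO `Z` (the in-coins of `Z`). -/
def intoC (arcs : E → Finset (V × V)) (Z : Set V) : Set E :=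
  {e | ∃ xy ∈ arcs e, xy.2 ∈ Z}

/-- `SameEnds`: any two arcs of a coin have the same endpoint set — single arcs, antiparallel
pairs and loops (the MIXED coin systems of row 2′DARC); preserved by deleting arcs. -/
def SameEnds (arcs : E → Finset (V × V)) : Prop :=
  ∀ e, ∀ xy ∈ arcs e, ∀ x'y' ∈ arcs e,
    (x'y'.1 = xy.1 ∨ x'y'.1 = xy.2) ∧ (x'y'.2 = xy.1 ∨ x'y'.2 = xy.2)

/-- The configuration induced on the vertex set `U`: every coin not inside `U` is closed. -/
noncomputable def inducedC (arcs : E → Finset (V × V)) (U : Set V) (ω : Config E) : Config E :=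
  restrict (withinC arcs U) ω

variable {arcs : E → Finset (V × V)}

/-- A coin is open in `inducedC arcs U ω` iff it is open in `ω` and lies inside `U`. -/
lemma inducedC_eq_true_iff {U : Set V} {ω : Config E} {e : E} :
    inducedC arcs U ω e = true ↔ ω e = true ∧ e ∈ withinC arcs U := by
  unfold inducedC
  exact restrict_eq_true_iff

/-- `inducedC arcs U ω ≤ ω`. -/
lemma inducedC_le (U : Set V) (ω : Config E) : inducedC arcs U ω ≤ ω :=
  restrict_le _ ω

/-- `withinC` is monotone in the vertex set. -/
lemma withinC_mono {U U' : Set V} (h : U ⊆ U') : withinC arcs U ⊆ withinC arcs U' :=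
  fun _ he xy hxy => ⟨h (he xy hxy).1, h (he xy hxy).2⟩

/-- `inducedC` is monotone in the configuration. -/
lemma inducedC_mono {U : Set V} {ω ω' : Config E} (h : ω ≤ ω') :
    inducedC arcs U ω ≤ inducedC arcs U ω' := by
  intro e
  by_cases he : e ∈ withinC arcs U
  · unfold inducedC
    rw [restrict_apply_of_mem he, restrict_apply_of_mem he]
    exact h e
  · unfold inducedC
    rw [restrict_apply_of_notMem he]
    exact Bool.false_le _

/-- `inducedC` is monotone in the vertex set. -/
lemma inducedC_mono_set {U U' : Set V} (h : U ⊆ U') (ω : Config E) :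
    inducedC arcs U ω ≤ inducedC arcs U' ω := by
  intro e
  by_cases he : e ∈ withinC arcs U
  · unfold inducedC
    rw [restrict_apply_of_mem he, restrict_apply_of_mem (withinC_mono h he)]
  · unfold inducedC
    rw [restrict_apply_of_notMem he]
    exact Bool.false_le _

/-- `inducedC arcs U` only sees the coins inside `U`. -/
lemma inducedC_congr {U : Set V} {ω ω' : Config E} (h : ∀ e ∈ withinC arcs U, ω e = ω' e) :
    inducedC arcs U ω = inducedC arcs U ω' := by
  unfold inducedC
  exact restrict_congr h

/-- Both endpoints of an open arc of `inducedC arcs U ω` lie in `U`. -/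
lemma mem_and_mem_of_openArc_inducedC {U : Set V} {ω : Config E} {x y : V}
    (h : OpenArc arcs (inducedC arcs U ω) x y) : x ∈ U ∧ y ∈ U := by
  obtain ⟨e, he, hxy⟩ := h
  obtain ⟨_, hw⟩ := inducedC_eq_true_iff.1 he
  exact hw (x, y) hxy

/-- An open arc of the induced configuration is an open arc of `ω`. -/
lemma openArc_of_openArc_inducedC {U : Set V} {ω : Config E} {x y : V}
    (h : OpenArc arcs (inducedC arcs U ω) x y) : OpenArc arcs ω x y :=
  openArc_mono (inducedC_le U ω) h

/-- Under `SameEnds`, a coin carrying an arc with both endpoints in `U` lies inside `U`. -/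
lemma mem_withinC_of_arc (hS : SameEnds arcs) {U : Set V} {e : E} {x y : V} (hxy : (x, y) ∈ arcs e)
    (hx : x ∈ U) (hy : y ∈ U) : e ∈ withinC arcs U := by
  intro x'y' hx'y'
  obtain ⟨h1, h2⟩ := hS e (x, y) hxy x'y' hx'y'
  constructor
  · rcases h1 with h | h <;> rw [h] <;> assumption
  · rcases h2 with h | h <;> rw [h] <;> assumption

/-- Under `SameEnds`, an open arc of `ω` with both endpoints in `U` is open in
`inducedC arcs U ω`. -/
lemma openArc_inducedC_of_openArc (hS : SameEnds arcs) {U : Set V} {ω : Config E} {x y : V}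
    (h : OpenArc arcs ω x y) (hx : x ∈ U) (hy : y ∈ U) :
    OpenArc arcs (inducedC arcs U ω) x y := by
  obtain ⟨e, he, hxy⟩ := h
  exact ⟨e, inducedC_eq_true_iff.2 ⟨he, mem_withinC_of_arc hS hxy hx hy⟩, hxy⟩

/-- Vertices reachable in `D[U]` from a vertex of `U` lie in `U`. -/
lemma mem_of_reach_inducedC {U : Set V} {ω : Config E} {u v : V} (hu : u ∈ U)
    (h : Reach arcs (inducedC arcs U ω) u v) : v ∈ U := by
  induction h with
  | refl => exact hu
  | tail _ hstep _ => exact (mem_and_mem_of_openArc_inducedC hstep).2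

/-- Reachability in the induced system is reachability in the whole system. -/
lemma reach_of_reach_inducedC {U : Set V} {ω : Config E} {u v : V}
    (h : Reach arcs (inducedC arcs U ω) u v) : Reach arcs ω u v :=
  reach_mono (inducedC_le U ω) h

/-- On the full vertex set nothing is closed: `inducedC arcs Set.univ ω = ω`. -/
lemma inducedC_univ (ω : Config E) : inducedC arcs Set.univ ω = ω := by
  funext e
  have he : e ∈ withinC arcs Set.univ := fun xy _ => ⟨Set.mem_univ _, Set.mem_univ _⟩
  unfold inducedC
  exact restrict_apply_of_mem he

/-- A coin of the join is open iff it is open in one of the two configurations. -/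
lemma sup_apply_eq_true_iff' (ω ω' : Config E) (e : E) :
    (ω ⊔ ω') e = true ↔ ω e = true ∨ ω' e = true := by
  simp only [Pi.sup_apply]
  cases ω e <;> cases ω' e <;> decide

/-- A coin of the meet is open iff it is open in both configurations. -/
lemma inf_apply_eq_true_iff' (ω ω' : Config E) (e : E) :
    (ω ⊓ ω') e = true ↔ ω e = true ∧ ω' e = true := by
  simp only [Pi.inf_apply]
  cases ω e <;> cases ω' e <;> decide

end Induced

/-! ## The events `Q^U_A` and `R^U_X` -/

section Events

variable {V : Type*} {E : Type*}

/-- `Q^U_A = {s ⇝ a in D[U] for all a ∈ A}`. -/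
def QEventC (arcs : E → Finset (V × V)) (U : Finset V) (s : V) (A : Finset V) :
    Set (Config E) :=
  {ω | ∀ a ∈ A, Reach arcs (inducedC arcs (↑U) ω) s a}

/-- `R^U_X = {s ↛ x in D[U] for all x ∈ X}`. -/
def REventC (arcs : E → Finset (V × V)) (U : Finset V) (s : V) (X : Finset V) :
    Set (Config E) :=
  {ω | ∀ x ∈ X, ¬ Reach arcs (inducedC arcs (↑U) ω) s x}

variable {arcs : E → Finset (V × V)} {U : Finset V} {s : V}

/-- Membership in `QEventC`. -/
@[simp] lemma mem_QEventC {A : Finset V} {ω : Config E} :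
    ω ∈ QEventC arcs U s A ↔ ∀ a ∈ A, Reach arcs (inducedC arcs (↑U) ω) s a := Iff.rfl

/-- Membership in `REventC`. -/
@[simp] lemma mem_REventC {X : Finset V} {ω : Config E} :
    ω ∈ REventC arcs U s X ↔ ∀ x ∈ X, ¬ Reach arcs (inducedC arcs (↑U) ω) s x := Iff.rfl

/-- `Q^U_A` is increasing. -/
lemma isUpperSet_QEventC (arcs : E → Finset (V × V)) (U : Finset V) (s : V) (A : Finset V) :
    IsUpperSet (QEventC arcs U s A) :=
  fun _ _ h hω a ha => reach_mono (inducedC_mono h) (hω a ha)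

/-- `R^U_X` is decreasing. -/
lemma isLowerSet_REventC (arcs : E → Finset (V × V)) (U : Finset V) (s : V) (X : Finset V) :
    IsLowerSet (REventC arcs U s X) :=
  fun _ _ h hω x hx hc => hω x hx (reach_mono (inducedC_mono h) hc)

/-- `Q^U_{A ∪ B} = Q^U_A ∩ Q^U_B`. -/
lemma QEventC_union [DecidableEq V] (arcs : E → Finset (V × V)) (U : Finset V) (s : V)
    (A B : Finset V) : QEventC arcs U s (A ∪ B) = QEventC arcs U s A ∩ QEventC arcs U s B := by
  ext ω
  simp only [mem_QEventC, Set.mem_inter_iff, Finset.forall_mem_union]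

/-- `R^U_{X ∪ Y} = R^U_X ∩ R^U_Y`. -/
lemma REventC_union [DecidableEq V] (arcs : E → Finset (V × V)) (U : Finset V) (s : V)
    (X Y : Finset V) : REventC arcs U s (X ∪ Y) = REventC arcs U s X ∩ REventC arcs U s Y := by
  ext ω
  simp only [mem_REventC, Set.mem_inter_iff, Finset.forall_mem_union]

/-- `Q^U_∅` is the sure event. -/
@[simp] lemma QEventC_empty (arcs : E → Finset (V × V)) (U : Finset V) (s : V) :
    QEventC arcs U s ∅ = Set.univ := by
  ext ω; simp

/-- `R^U_∅` is the sure event. -/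
@[simp] lemma REventC_empty (arcs : E → Finset (V × V)) (U : Finset V) (s : V) :
    REventC arcs U s ∅ = Set.univ := by
  ext ω; simp

/-- `R^U_X` is antitone in `X`. -/
lemma REventC_anti (arcs : E → Finset (V × V)) (U : Finset V) (s : V) {X X' : Finset V}
    (h : X ⊆ X') : REventC arcs U s X' ⊆ REventC arcs U s X :=
  fun _ hω x hx => hω x (h hx)

/-- `Q^U_A` is antitone in `A`. -/
lemma QEventC_anti (arcs : E → Finset (V × V)) (U : Finset V) (s : V) {A A' : Finset V}
    (h : A ⊆ A') : QEventC arcs U s A' ⊆ QEventC arcs U s A :=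
  fun _ hω a ha => hω a (h ha)

/-- If `s ∈ X` then `R^U_X` is empty. -/
lemma REventC_eq_empty_of_mem (arcs : E → Finset (V × V)) (U : Finset V) {s : V} {X : Finset V}
    (hs : s ∈ X) : REventC arcs U s X = ∅ := by
  ext ω
  simp only [mem_REventC, Set.mem_empty_iff_false, iff_false, not_forall, not_not]
  exact ⟨s, hs, reach_refl _ _ _⟩

/-- `Q^U_A` is determined by the coins inside `U`. -/
lemma dependsOn_QEventC (arcs : E → Finset (V × V)) (U : Finset V) (s : V) (A : Finset V) :
    DependsOn (· ∈ QEventC arcs U s A) (withinC arcs (↑U)) := by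
  intro ω ω' h
  show (∀ a ∈ A, Reach arcs (inducedC arcs (↑U) ω) s a) =
    ∀ a ∈ A, Reach arcs (inducedC arcs (↑U) ω') s a
  rw [inducedC_congr h]

/-- `R^U_X` is determined by the coins inside `U`. -/
lemma dependsOn_REventC (arcs : E → Finset (V × V)) (U : Finset V) (s : V) (X : Finset V) :
    DependsOn (· ∈ REventC arcs U s X) (withinC arcs (↑U)) := by
  intro ω ω' h
  show (∀ x ∈ X, ¬ Reach arcs (inducedC arcs (↑U) ω) s x) =
    ∀ x ∈ X, ¬ Reach arcs (inducedC arcs (↑U) ω') s x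
  rw [inducedC_congr h]

/-- On the full vertex set, `Q^{univ}_A` is the whole-system event `{s ⇝ a ∀ a ∈ A}`. -/
lemma QEventC_univ [Fintype V] (arcs : E → Finset (V × V)) (s : V) (A : Finset V) :
    QEventC arcs Finset.univ s A = {ω | ∀ a ∈ A, Reach arcs ω s a} := by
  ext ω
  simp only [mem_QEventC, Set.mem_setOf_eq, Finset.coe_univ, inducedC_univ]

/-- On the full vertex set, `R^{univ}_X` is the avoidance event `avoidEvent arcs s X`. -/
lemma REventC_univ [Fintype V] (arcs : E → Finset (V × V)) (s : V) (X : Finset V) :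
    REventC arcs Finset.univ s X = avoidEvent arcs s X := by
  ext ω
  simp only [mem_REventC, avoidEvent, Set.mem_setOf_eq, Finset.coe_univ, inducedC_univ]

end Events

/-! ## The in-frontier of `Z` (definition) -/

section FrontierDef

variable {V : Type*} {E : Type*} [Fintype E] [DecidableEq V]

/-- The in-frontier of `Z` in `U`: the vertices of `U ∖ Z` carrying an open arc of `ω` INTO `Z`
(what exploring the in-coins of `Z` reveals). -/
def frontierC (arcs : E → Finset (V × V)) (U Z : Finset V) (ω : Config E) : Finset V :=
  (U \ Z).filter fun y => ∃ e, ω e = true ∧ ∃ z ∈ Z, (y, z) ∈ arcs e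

variable {arcs : E → Finset (V × V)} {U Z : Finset V}

/-- Membership in the in-frontier. -/
lemma mem_frontierC {ω : Config E} {y : V} :
    y ∈ frontierC arcs U Z ω ↔
      (y ∈ U ∧ y ∉ Z) ∧ ∃ e, ω e = true ∧ ∃ z ∈ Z, (y, z) ∈ arcs e := by
  simp only [frontierC, Finset.mem_filter, Finset.mem_sdiff]

/-- The in-frontier lies in `U ∖ Z`. -/
lemma frontierC_subset (ω : Config E) : frontierC arcs U Z ω ⊆ U \ Z :=
  Finset.filter_subset _ _

end FrontierDef

end Summit.Ventures.PercRepro2.Coin
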